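import Mathlib
import HarnessLib
import Summits.ResolutionOfSingularities.ResolutionOfSingularities.Theorems.WildQuotientsWildQuotientResolutionS1aKillFreeTransport

/-!
# S1a — K-FREE FRAME, producer tools IV: `PrincipalNear` is invariant under RESTRICTION to an invariant basic open (bookkeeping B1, restriction half)

[OURS · L1 W4.5c · lead-1 g11; plan-1 ASSIGNMENT v10.34 (F-T2), A-KF v0 (O3)/(B1); companion of `…S1aKillFreeTransport`] — NOT statements of the manuscript;
counted 0; AI-level work, weaker than expert review. Crux stmt-ResolutionOfSingularities-17941 `CyclicQuotientFourfolds`, line `s1a-logminvertex` v12. Route-independent.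

* ★ `NodeData.principalNear_restrict_iff` — on an INTEGRAL scheme, for an invariant section `b` and `u ∈ D(b)`:
  `(D.restrict hb).PrincipalNear u ↔ D.PrincipalNear u`. Proof: a witness `c′ ∈ Γ(V, D(b))` is normalised to `c′ · b̄ᵏ = c̄` with `c ∈ Γ(V, O)`
  (`IsLocalization.surj`); `KilledAway` is monotone, so `c̄` is again a witness; `c` is invariant because `Γ(V, O) → Γ(V, D(b))` is injective
  (integral scheme) and `c′`, `b` are invariant; and `KilledAway` of the restriction at `c̄` is `KilledAway D (e b · e c)` (`killedAway_restrict_algebraMap_iff`).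
-/

set_option linter.dupNamespace false

noncomputable section

universe u

open CategoryTheory Limits AlgebraicGeometry TopologicalSpace Topology
open Literature.AlgebraicGeometry.Resolution Literature.AlgebraicGeometry.RelativeSpec
open Summit.ResolutionOfSingularities.ResolutionOfSingularities.Theorems.WildQuotientResolution.S1
open Summit.ResolutionOfSingularities.ResolutionOfSingularities.Theorems.WildQuotientResolution.S1.NodeAtlas
open Summit.ResolutionOfSingularities.ResolutionOfSingularities.Theorems.WildQuotientResolution.S1.GoodCharts
open Summit.ResolutionOfSingularities.ResolutionOfSingularities.Theorems.WildQuotientResolution.S1.NodeChartAway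
open Summit.ResolutionOfSingularities.ResolutionOfSingularities.Theorems.WildQuotientResolution.S1.NodeAway
open Summit.ResolutionOfSingularities.ResolutionOfSingularities.Theorems.WildQuotientResolution.S1.GradedLocalization

namespace Summit.ResolutionOfSingularities.ResolutionOfSingularities.Theorems.WildQuotientResolution.S1.NpFrame.NodeData

variable {p : ℕ} {V Y : Scheme.{u}} {q : V ⟶ Y} {G : Type u} [Group G] {ρ : ActionOver q G} {g₀ : G}
  {O : ρ.StableAffineOpens} (D : NodeData p ρ g₀ O) {b : Γ(V, O.1)} (hb : ∀ g : G, actO ρ O g b = b)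

/-- Restricted sections: the action on `Γ(V, D(b))` extends the action on `Γ(V, O)`. -/
theorem actO_basicOpenStable_algebraMap (g : G) (c : Γ(V, O.1)) :
    actO ρ (basicOpenStable ρ O D.affine hb) g (algebraMap Γ(V, O.1) Γ(V, V.basicOpen b) c) =
      algebraMap Γ(V, O.1) Γ(V, V.basicOpen b) (actO ρ O g c) :=
  act_basicOpen_algebraMap ρ O hb g c

/-- The coordinate map of the restriction is multiplicative on the underlying node ring (coercion form). -/
theorem coe_restrict_e_mul (x y : Γ(V, (basicOpenStable ρ O D.affine hb).1)) :
    letI := (D.restrict hb).instCommRing; letI := (D.restrict hb).instGradedRing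
    ((((D.restrict hb).e (x * y)) : ↥((D.restrict hb).𝒜 0)) : (D.restrict hb).B) =
      (((D.restrict hb).e x : ↥((D.restrict hb).𝒜 0)) : (D.restrict hb).B) * (((D.restrict hb).e y : ↥((D.restrict hb).𝒜 0)) : (D.restrict hb).B) := by
  letI := (D.restrict hb).instCommRing; letI := (D.restrict hb).instGradedRing
  rw [map_mul]
  rfl

variable [IsIntegral V]

/-- ★ **`PrincipalNear` is invariant under restriction** (bookkeeping lemma B1, restriction half): for `u ∈ D(b)`,
`(D.restrict hb).PrincipalNear u ↔ D.PrincipalNear u`. [OURS · L1 W4.5c · (F-T2)] -/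
theorem principalNear_restrict_iff {u : V} (hub : u ∈ V.basicOpen b) : (D.restrict hb).PrincipalNear u ↔ D.PrincipalNear u := by
  letI := D.instCommRing; letI := D.instGradedRing
  letI := (D.restrict hb).instCommRing; letI := (D.restrict hb).instGradedRing
  -- the section ring of the shrunk chart, as a localisation of `Γ(V, O)` at `b`
  let S : Type u := Γ(V, (basicOpenStable ρ O D.affine hb).1)
  letI algS : Algebra Γ(V, O.1) S := Scheme.algebra_section_section_basicOpen b
  haveI hloc : IsLocalization.Away b S := D.affine.isLocalization_basicOpen b
  have halg : ∀ c : Γ(V, O.1), algebraMap Γ(V, O.1) S c = algebraMap Γ(V, O.1) Γ(V, V.basicOpen b) c := fun _ => rfl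
  have hbo : ∀ c : Γ(V, O.1), V.basicOpen (algebraMap Γ(V, O.1) S c) = V.basicOpen b ⊓ V.basicOpen c :=
    fun c => Scheme.basicOpen_res V c (homOfLE (V.basicOpen_le b)).op
  have hact : ∀ (g : G) (c : Γ(V, O.1)), actO ρ (basicOpenStable ρ O D.affine hb) g (algebraMap Γ(V, O.1) S c) =
      algebraMap Γ(V, O.1) S (actO ρ O g c) := fun g c => act_basicOpen_algebraMap ρ O hb g c
  rw [D.principalNear_iff_killedAway_mul hb hub]
  constructor
  · rintro ⟨c', hc', huc', hk'⟩
    -- normalise the witness into the image of `Γ(V, O)`: `c' * b̄^k = c̄`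
    obtain ⟨⟨c, ⟨_, k, rfl⟩⟩, hcc'⟩ := IsLocalization.surj (M := Submonoid.powers b) (S := S) c'
    have hcc : c' * algebraMap Γ(V, O.1) S (b ^ k) = algebraMap Γ(V, O.1) S c := hcc'
    haveI : IsDomain Γ(V, O.1) := @IsIntegral.component_integral _ _ O.1 ⟨⟨u, V.basicOpen_le b hub⟩⟩
    have hb0 : b ≠ 0 := by
      rintro rfl
      rw [Scheme.basicOpen_zero] at hub
      exact hub
    have hinj : Function.Injective (algebraMap Γ(V, O.1) S) :=
      IsLocalization.injective S (powers_le_nonZeroDivisors_of_noZeroDivisors hb0)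
    refine ⟨c, fun g => hinj ?_, ?_, ?_⟩
    · -- invariance of `c` from invariance of `c'` and `b`
      rw [← hact g c, ← hcc, map_mul, hc' g, hact g (b ^ k), map_pow, hb g]
    · -- `u ∈ D(c)`
      have hmem : u ∈ V.basicOpen (algebraMap Γ(V, O.1) S c) := by
        rw [← hcc, Scheme.basicOpen_mul]
        refine ⟨huc', ?_⟩
        rw [map_pow]
        rcases Nat.eq_zero_or_pos k with hk | hk
        · rw [hk, pow_zero, V.basicOpen_of_isUnit isUnit_one]; exact V.basicOpen_le c' huc'
        · rw [V.basicOpen_pow _ hk, hbo]; exact ⟨hub, V.basicOpen_le c' huc'⟩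
      rw [hbo] at hmem
      exact hmem.2
    · -- `KilledAway` is monotone: `c' ↦ c' * b̄^k = c̄`, then the identification lemma
      have hk2 : (D.restrict hb).KilledAway ((((D.restrict hb).e c' : ↥((D.restrict hb).𝒜 0)) : (D.restrict hb).B) *
          (((D.restrict hb).e (algebraMap Γ(V, O.1) S (b ^ k)) : ↥((D.restrict hb).𝒜 0)) : (D.restrict hb).B)) :=
        (D.restrict hb).killedAway_mul hk' _
      rw [← D.coe_restrict_e_mul hb, hcc] at hk2
      exact (D.killedAway_restrict_algebraMap_iff hb c).mp hk2
  · rintro ⟨c, hc, huc, hk⟩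
    refine ⟨algebraMap Γ(V, O.1) S c, fun g => ?_, ?_, (D.killedAway_restrict_algebraMap_iff hb c).mpr hk⟩
    · rw [hact g c, hc g]
    · show u ∈ V.basicOpen (algebraMap Γ(V, O.1) S c)
      rw [hbo]
      exact ⟨hub, huc⟩

end Summit.ResolutionOfSingularities.ResolutionOfSingularities.Theorems.WildQuotientResolution.S1.NpFrame.NodeData

end
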